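import Summits.KontsevichZagierPeriods.KontsevichZagierPeriods.Theorems.RootDecompRelativeModAbsoluteCylLogSplitP41

/-! # `RootDecompRelativeModAbsoluteCylLogSplitP42` — part 17/27 of the mechanical ≤400-line split of `RungClosure.lean` (sha256 f909f334226f0fb5…)
Source: decomp-kz lens-3 g12 `RungClosure.lean` v9 (HOME/decomp-kz-lens-3/g12/, sha256 f909f334…; critic g4-52/g4-57/g5 CLEARED, «lander: split v9 --supports 30572»): BLOCK I (57 g11 monolith decls missing from P01–P25), BLOCK II/III (WildCertAssembly parts 1–6, 8–10: `Leaf.cellLocalWildCert`, `Leaf.cylKernelZeroLog_of_trees`), Parts 12–13 (`Leaf.regKernelPairDegOne_iff_circlePos_of_trees`), BLOCK G13 (Möbius engine, test §C decided).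
Split by census-1 g9 `gen/splitlean.py`: scopes re-opened with their `open`/`variable`/`set_option` context; mathematics and declaration order unchanged. -/

noncomputable section
open Set MeasureTheory Filter Topology
open scoped BigOperators
open Literature.NumberTheory.Transcendental Literature.ModelTheory.ExponentialFields
namespace Summit.KontsevichZagierPeriods.RootDecompRelativeModAbsolute.Rung30571.RegularisedLogLayer.CylLog.Leaf
section T3
variable {q : ℕ}

/-- **T3 — `wildCellCert_of_pointwise`.**  The wild certificate of a piece from pointwise bounds (see the Part 9
header).  Hypotheses: the `CellCloseLS` binders restricted to the piece `C`; the Γ-lattice data of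
`latticeSplitΓ q R f Z`; the regime `Z` small / non-`Z` away / `Z`-rates comparable at order `m` / one-signed torus
products.  Conclusion: `WildCellCert C c κ M σ` with `qq'_s = Σ_r A_sr qq_r`, `Ñᵢ = Σ_t (Σ_r B_tr qq_r) h_ti`. -/
theorem wildCellCert_of_pointwise {C : Set (Fin 1 → ℝ)} (hC : IsSemialgebraic ℚ C)
    {c κ : Fin q → (Fin 1 → ℝ) → ℝ} {M : Fin q → ℕ} {σ : Fin q → Fin 3}
    (hc : ∀ i, IsSemialgebraicFunOn ℚ C (c i)) (hκ : ∀ i, IsSemialgebraicFunOn ℚ C (κ i))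
    (hκ1 : ∀ i, ∀ x ∈ C, -1 < κ i x)
    (hσ0 : ∀ i, σ i = 0 → ∀ x ∈ C, 0 < κ i x) (hσ1 : ∀ i, σ i = 1 → ∀ x ∈ C, κ i x < 0)
    (hσ2 : ∀ i, σ i = 2 → ∀ x ∈ C, κ i x = 0)
    (hL1 : ∀ i, IntegrableOn (fun x => c i x * ∫ θ in Set.Ioo (0:ℝ) 1, θ ^ M i / (1 + θ * κ i x)) C)
    {R : ℕ} {f : Fin R → Fin q → ℤ} {qq : Fin R → (Fin 1 → ℝ) → ℝ}
    (hqq : ∀ r, IsSemialgebraicFunOn ℚ C (qq r))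
    (hprod : ∀ r, ∀ x ∈ C, ∏ i, (1 + κ i x) ^ (f r i) = 1)
    (hcoef : ∀ i, ∀ x ∈ C, logCoef (sgnB σ) c κ M i x = ∑ r, qq r x * (f r i : ℝ))
    {a b : ℕ} {g : Fin a → Fin q → ℤ} {h : Fin b → Fin q → ℤ} {A : Fin a → Fin R → ℚ}
    {B : Fin b → Fin R → ℚ} {β : Fin b → Fin q → ℚ} {α : Fin a → Fin q → ℚ} {Z : Fin q → Bool}
    (hgZ : ∀ s i, Z i = false → g s i = 0)
    (hgrel : ∀ s, ∃ N : ℕ, 0 < N ∧ ∃ z : Fin R → ℤ, ∀ i, (N : ℤ) * g s i = ∑ r, z r * f r i)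
    (hhrel : ∀ t, ∃ N : ℕ, 0 < N ∧ ∃ z : Fin R → ℤ, ∀ i, (N : ℤ) * h t i = ∑ r, z r * f r i)
    (hβZ : ∀ t k, Z k = true → β t k = 0)
    (hI1 : ∀ r i, (f r i : ℚ) = ∑ s, A s r * g s i + ∑ t, B t r * h t i)
    (hI2 : ∀ t r, B t r = ∑ k, β t k * f r k) (hI3 : ∀ s r, A s r = ∑ k, α s k * f r k)
    {m : ℕ} {δ Cρ : ℝ} (hδ : 0 < δ) (hCρ : 0 ≤ Cρ)
    (hZσ : ∀ i, Z i = true → σ i ≠ 2) (hZM : ∀ i, Z i = true → M i ≤ m)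
    (hZsmall : ∀ i, Z i = true → ∀ x ∈ C, |κ i x| ≤ 1 / 2)
    (haway : ∀ i, Z i = false → σ i ≠ 2 → ∀ x ∈ C, δ ≤ |κ i x|)
    (hrat : ∀ i k, Z i = true → Z k = true → ∀ x ∈ C, |κ i x| ^ (m + 1) ≤ Cρ * |κ k x| ^ (M k + 1))
    (hL : ∀ s, (∀ x ∈ C, 1 ≤ ∏ i, zW Z (fun i x => 1 + κ i x) i x ^ (g s i).toNat) ∨
      (∀ x ∈ C, ∏ i, zW Z (fun i x => 1 + κ i x) i x ^ (g s i).toNat ≤ 1)) :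
    WildCellCert C c κ M σ := by
  classical
  have hCm : MeasurableSet C := hC.measurableSet_holds
  have hk0 : ∀ i, σ i ≠ 2 → ∀ x ∈ C, κ i x ≠ 0 := Tame.ne_zero_of_sigma_ne_two hσ0 hσ1
  have hWpos : ∀ i, ∀ x ∈ C, 0 < 1 + κ i x := fun i x hx => by linarith [hκ1 i x hx]
  have hWZ : ∀ i, Z i = true → ∀ x ∈ C, 1 / 2 ≤ 1 + κ i x := fun i hi x hx => by
    linarith [(abs_le.1 (hZsmall i hi x hx)).1]
  -- the derived data
  set D : Fin q → (Fin 1 → ℝ) → ℝ := fun k x => ∑ r, qq r x * (f r k : ℝ) with hDdef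
  set QQ : Fin a → (Fin 1 → ℝ) → ℝ := fun s x => ∑ r, (A s r : ℝ) * qq r x with hQQdef
  set PP : Fin b → (Fin 1 → ℝ) → ℝ := fun t x => ∑ r, (B t r : ℝ) * qq r x with hPPdef
  set Nn : Fin q → (Fin 1 → ℝ) → ℝ := fun i x => ∑ t, PP t x * (h t i : ℝ) with hNndef
  set u : (Fin 1 → ℝ) → ℝ := fun x => ∑ i, (if Z i = true then |κ i x| else 0) with hudef
  -- (1) pointwise identities
  have hD : ∀ k, ∀ x ∈ C, (-1) ^ M k * (c k x / κ k x ^ (M k + 1)) = D k x := by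
    intro k x hx
    show (-1) ^ M k * (c k x / κ k x ^ (M k + 1)) = ∑ r, qq r x * (f r k : ℝ)
    rw [← hcoef k x hx]
    by_cases h2 : σ k = 2
    · have hs : sgnB σ k = false := by simp [sgnB, h2]
      simp [logCoef, hs, hσ2 k h2 x hx]
    · have hs : sgnB σ k = true := by simp [sgnB, h2]
      simp only [logCoef, hs, if_true]
      ring
  have hDZ : ∀ k, Z k = true → ∀ x ∈ C, D k x = (-1) ^ M k * c k x / κ k x ^ (M k + 1) := by
    intro k _ x hx
    rw [← hD k x hx]
    ring
  have hD2 : ∀ k, σ k = 2 → ∀ x ∈ C, D k x = 0 := by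
    intro k h2 x hx
    rw [← hD k x hx, hσ2 k h2 x hx]
    simp
  have hQQ : ∀ s x, QQ s x = ∑ k, (α s k : ℝ) * D k x := fun s x => sum_coeff_comb (hI3 s) (fun r => qq r x)
  have hPP : ∀ t x, PP t x = ∑ k, (β t k : ℝ) * D k x := fun t x => sum_coeff_comb (hI2 t) (fun r => qq r x)
  have hsplit : ∀ i x, D i x = ∑ s, QQ s x * (g s i : ℝ) + Nn i x := fun i x =>
    (Lattice.latticeSplit_real hI1 hI2 (fun r => qq r x)).1 i
  have hNnD : ∀ i, Z i = false → ∀ x, Nn i x = D i x := by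
    intro i hi x
    have h1 := hsplit i x
    have h0 : ∑ s, QQ s x * (g s i : ℝ) = 0 := Finset.sum_eq_zero fun s _ => by rw [hgZ s i hi]; simp
    rw [h0, zero_add] at h1
    exact h1.symm
  have hNnγ : ∀ i x, Nn i x = ∑ k, (∑ t, (β t k : ℝ) * (h t i : ℝ)) * D k x := by
    intro i x
    show ∑ t, PP t x * (h t i : ℝ) = ∑ k, (∑ t, (β t k : ℝ) * (h t i : ℝ)) * D k x
    simp only [hPP, Finset.sum_mul]
    rw [Finset.sum_comm]
    exact Finset.sum_congr rfl fun k _ => Finset.sum_congr rfl fun t _ => by ring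
  -- (2) relations and the vanishing log-sum
  have hrelg : ∀ s, ∀ x ∈ C, ∏ i, (1 + κ i x) ^ (g s i) = 1 := by
    intro s x hx
    obtain ⟨N, hN, z, hz⟩ := hgrel s
    exact Lattice.prod_zpow_eq_one_of_int_combination hN hz (fun i => hWpos i x hx) (fun r => hprod r x hx)
  have hrelh : ∀ t, ∀ x ∈ C, ∏ i, (1 + κ i x) ^ (h t i) = 1 := by
    intro t x hx
    obtain ⟨N, hN, z, hz⟩ := hhrel t
    exact Lattice.prod_zpow_eq_one_of_int_combination hN hz (fun i => hWpos i x hx) (fun r => hprod r x hx)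
  have hsumN : ∀ x ∈ C, ∑ i, Nn i x * Real.log (1 + κ i x) = 0 := by
    intro x hx
    have hh : ∀ t, ∑ i, (h t i : ℝ) * Real.log (1 + κ i x) = 0 := fun t =>
      sum_mul_log_eq_zero_of_prod_zpow (fun i => hWpos i x hx) (hrelh t x hx)
    calc ∑ i, Nn i x * Real.log (1 + κ i x)
        = ∑ t, PP t x * ∑ i, (h t i : ℝ) * Real.log (1 + κ i x) := by
          simp only [hNndef, Finset.sum_mul, Finset.mul_sum]
          rw [Finset.sum_comm]
          exact Finset.sum_congr rfl fun t _ => Finset.sum_congr rfl fun i _ => by ring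
      _ = 0 := by simp [hh]
  -- (3) semialgebraicity
  have h1 : IsSemialgebraicFunOn ℚ C (fun _ => (1:ℝ)) :=
    (isSemialgebraicFunOn_const_natCast hC 1).congr fun _ _ => by simp
  have h1κ : ∀ i, IsSemialgebraicFunOn ℚ C (fun x => 1 + κ i x) := fun i => h1.fun_add (hκ i)
  have hDsa : ∀ k, IsSemialgebraicFunOn ℚ C (D k) := fun k =>
    IsSemialgebraicFunOn.fun_finsetSum Finset.univ hC fun r _ =>
      (hqq r).fun_mul ((isSemialgebraicFunOn_ratCast hC (f r k : ℚ)).congr fun _ _ => by simp)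
  have hQQsa : ∀ s, IsSemialgebraicFunOn ℚ C (QQ s) := fun s =>
    IsSemialgebraicFunOn.fun_finsetSum Finset.univ hC fun r _ =>
      (isSemialgebraicFunOn_ratCast hC (A s r)).fun_mul (hqq r)
  have hPPsa : ∀ t, IsSemialgebraicFunOn ℚ C (PP t) := fun t =>
    IsSemialgebraicFunOn.fun_finsetSum Finset.univ hC fun r _ =>
      (isSemialgebraicFunOn_ratCast hC (B t r)).fun_mul (hqq r)
  have hNnsa : ∀ i, IsSemialgebraicFunOn ℚ C (Nn i) := fun i =>
    IsSemialgebraicFunOn.fun_finsetSum Finset.univ hC fun t _ =>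
      (hPPsa t).fun_mul ((isSemialgebraicFunOn_ratCast hC (h t i : ℚ)).congr fun _ _ => by simp)
  have hPsa : ∀ n : Fin q → ℕ, IsSemialgebraicFunOn ℚ C (fun x => ∏ i, zW Z (fun i x => 1 + κ i x) i x ^ n i) :=
    fun n => IsSemialgebraicFunOn.fun_finsetProd Finset.univ hC fun i _ => isSemialgebraicFunOn_zW_pow hC hκ Z n i
  have aesm : ∀ {F : (Fin 1 → ℝ) → ℝ}, IsSemialgebraicFunOn ℚ C F → AEStronglyMeasurable F (volume.restrict C) :=
    fun hF => KZ.aestronglyMeasurable_of_isSemialgebraicFunOn hF hCm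
  have hlogm : ∀ i, AEStronglyMeasurable (fun x => Real.log (1 + κ i x)) (volume.restrict C) := fun i =>
    (Real.measurable_log.comp_aemeasurable (aesm (h1κ i)).aemeasurable).aestronglyMeasurable
  -- (4) the size function `u`
  have hv0 : ∀ i x, 0 ≤ (if Z i = true then |κ i x| else 0) := fun i x => by
    split_ifs <;> simp [abs_nonneg]
  have hu0 : ∀ x, 0 ≤ u x := fun x => Finset.sum_nonneg fun i _ => hv0 i x
  have hκu : ∀ i, Z i = true → ∀ x, |κ i x| ≤ u x := by
    intro i hi x
    have h1 := Finset.single_le_sum (f := fun j => if Z j = true then |κ j x| else 0) (fun j _ => hv0 j x)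
      (Finset.mem_univ i)
    simpa [hi] using h1
  have huq : ∀ x ∈ C, u x ≤ q := by
    intro x hx
    calc u x ≤ ∑ _i : Fin q, (1:ℝ) := Finset.sum_le_sum fun i _ => by
            by_cases hi : Z i = true
            · rw [if_pos hi]; linarith [hZsmall i hi x hx]
            · rw [if_neg hi]; norm_num
      _ = q := by simp
  set Cu : ℝ := (q : ℝ) ^ (m + 1) * Cρ with hCudef
  have hCu0 : 0 ≤ Cu := by positivity
  have hupow : ∀ k, Z k = true → ∀ x ∈ C, u x ^ (m + 1) ≤ Cu * |κ k x| ^ (M k + 1) := by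
    intro k hk x hx
    obtain ⟨j, -, hj⟩ := Finset.exists_max_image Finset.univ (fun i => if Z i = true then |κ i x| else 0)
      ⟨k, Finset.mem_univ k⟩
    have hule : u x ≤ q * (if Z j = true then |κ j x| else 0) := by
      calc u x ≤ ∑ _i : Fin q, (if Z j = true then |κ j x| else 0) :=
            Finset.sum_le_sum fun i _ => hj i (Finset.mem_univ i)
        _ = q * (if Z j = true then |κ j x| else 0) := by simp
    by_cases hZj : Z j = true
    · rw [if_pos hZj] at hule
      calc u x ^ (m + 1) ≤ ((q:ℝ) * |κ j x|) ^ (m + 1) := pow_le_pow_left₀ (hu0 x) hule _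
        _ = (q:ℝ) ^ (m + 1) * |κ j x| ^ (m + 1) := mul_pow _ _ _
        _ ≤ (q:ℝ) ^ (m + 1) * (Cρ * |κ k x| ^ (M k + 1)) :=
            mul_le_mul_of_nonneg_left (hrat j k hZj hk x hx) (by positivity)
        _ = Cu * |κ k x| ^ (M k + 1) := by rw [hCudef]; ring
    · rw [if_neg hZj, mul_zero] at hule
      have hu00 : u x = 0 := le_antisymm hule (hu0 x)
      rw [hu00, zero_pow (Nat.succ_ne_zero m)]
      positivity
  -- (5) the L¹ inputs
  have hcL1 : ∀ k, Z k = true → IntegrableOn (c k) C := fun k hk =>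
    Tame.integrableOn_coeff_of_abs_le hC (hc k) (M k) (hκ1 k) (hZsmall k hk) (hL1 k)
  have hdL1 : ∀ k, Z k = false → σ k ≠ 2 → IntegrableOn (fun x => c k x / κ k x ^ (M k + 1)) C :=
    fun k hk h2 => Tame.integrableOn_regCoeff_of_away hC (hc k) (hκ k) (M k) hδ (hκ1 k) (haway k hk h2) (hL1 k)
  have htame : ∀ k, Z k = false → σ k ≠ 2 →
      IntegrableOn (fun x => c k x / κ k x ^ (M k + 1) * Real.log (1 + κ k x)) C ∧
      ∀ j, j < M k → IntegrableOn (fun x => c k x / κ k x ^ (M k + 1) * κ k x ^ (j + 1)) C :=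
    fun k hk h2 => Tame.tame_of_away hC (hc k) (hκ k) (M k) hδ (hκ1 k) (haway k hk h2) (hL1 k)
  have hDL1 : ∀ k, Z k = false → IntegrableOn (D k) C := by
    intro k hk
    by_cases h2 : σ k = 2
    · exact IntegrableOn.congr_fun integrableOn_zero (fun x hx => (hD2 k h2 x hx).symm) hCm
    · exact IntegrableOn.congr_fun ((hdL1 k hk h2).const_mul ((-1:ℝ) ^ M k)) (fun x hx => hD k x hx) hCm
  -- (6) the two domination engines
  have hcore : ∀ (Φ : (Fin 1 → ℝ) → ℝ) (L : ℝ), 0 ≤ L → AEStronglyMeasurable Φ (volume.restrict C) →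
      (∀ x ∈ C, |Φ x| ≤ L * u x ^ (m + 1)) → ∀ k, IntegrableOn (fun x => D k x * Φ x) C := by
    intro Φ L hL hΦm hΦb k
    have hmeas : AEStronglyMeasurable (fun x => D k x * Φ x) (volume.restrict C) := (aesm (hDsa k)).mul hΦm
    by_cases hk : Z k = true
    · refine integrableOn_of_abs_le_mul hCm (hcL1 k hk) hmeas (L * Cu) fun x hx => ?_
      have hκ0 : κ k x ≠ 0 := hk0 k (hZσ k hk) x hx
      have hκpos : 0 < |κ k x| ^ (M k + 1) := pow_pos (abs_pos.2 hκ0) _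
      rw [abs_mul, hDZ k hk x hx, abs_div, abs_mul, abs_pow, abs_pow, abs_neg, abs_one, one_pow, one_mul]
      calc |c k x| / |κ k x| ^ (M k + 1) * |Φ x|
          ≤ |c k x| / |κ k x| ^ (M k + 1) * (L * u x ^ (m + 1)) := by gcongr; exact hΦb x hx
        _ ≤ |c k x| / |κ k x| ^ (M k + 1) * (L * (Cu * |κ k x| ^ (M k + 1))) := by
            gcongr; exact hupow k hk x hx
        _ = L * Cu * |c k x| := by field_simp
    · have hk' : Z k = false := by simpa using hk
      refine integrableOn_of_abs_le_mul hCm (hDL1 k hk') hmeas (L * (q:ℝ) ^ (m + 1)) fun x hx => ?_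
      rw [abs_mul]
      have h1 : |Φ x| ≤ L * (q:ℝ) ^ (m + 1) :=
        (hΦb x hx).trans (mul_le_mul_of_nonneg_left (pow_le_pow_left₀ (hu0 x) (huq x hx) _) hL)
      calc |D k x| * |Φ x| ≤ |D k x| * (L * (q:ℝ) ^ (m + 1)) := by gcongr
        _ = L * (q:ℝ) ^ (m + 1) * |D k x| := by ring
  have hQQint : ∀ (Φ : (Fin 1 → ℝ) → ℝ) (L : ℝ), 0 ≤ L → AEStronglyMeasurable Φ (volume.restrict C) →
      (∀ x ∈ C, |Φ x| ≤ L * u x ^ (m + 1)) → ∀ s, IntegrableOn (fun x => QQ s x * Φ x) C := by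
    intro Φ L hL hΦm hΦb s
    have hsum := integrable_finsetSum (μ := volume.restrict C) Finset.univ
      fun k (_ : k ∈ Finset.univ) => (hcore Φ L hL hΦm hΦb k).const_mul (α s k : ℝ)
    have heq : (fun x => QQ s x * Φ x) = fun x => ∑ k, (α s k : ℝ) * (D k x * Φ x) := by
      funext x
      rw [hQQ s x, Finset.sum_mul]
      exact Finset.sum_congr rfl fun k _ => by ring
    rw [IntegrableOn, heq]
    exact hsum
  have hNNint : ∀ (Φ : (Fin 1 → ℝ) → ℝ) (L : ℝ), AEStronglyMeasurable Φ (volume.restrict C) →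
      (∀ x ∈ C, |Φ x| ≤ L) → ∀ i, IntegrableOn (fun x => Nn i x * Φ x) C := by
    intro Φ L hΦm hΦb i
    have hterm : ∀ k, IntegrableOn (fun x => (∑ t, (β t k : ℝ) * (h t i : ℝ)) * (D k x * Φ x)) C := by
      intro k
      by_cases hk : Z k = true
      · have h0 : ∑ t, (β t k : ℝ) * (h t i : ℝ) = 0 :=
          Finset.sum_eq_zero fun t _ => by rw [hβZ t k hk]; simp
        rw [h0]
        simp only [zero_mul]
        exact integrableOn_zero
      · have hk' : Z k = false := by simpa using hk
        have hDΦ : IntegrableOn (fun x => D k x * Φ x) C :=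
          integrableOn_of_abs_le_mul hCm (hDL1 k hk') ((aesm (hDsa k)).mul hΦm) L fun x hx => by
            rw [abs_mul]
            calc |D k x| * |Φ x| ≤ |D k x| * L := by gcongr; exact hΦb x hx
              _ = L * |D k x| := mul_comm _ _
        exact hDΦ.const_mul _
    have hsum := integrable_finsetSum (μ := volume.restrict C) Finset.univ fun k (_ : k ∈ Finset.univ) => hterm k
    have heq : (fun x => Nn i x * Φ x) = fun x => ∑ k, (∑ t, (β t k : ℝ) * (h t i : ℝ)) * (D k x * Φ x) := by
      funext x
      rw [hNnγ i x, Finset.sum_mul]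
      exact Finset.sum_congr rfl fun k _ => by ring
    rw [IntegrableOn, heq]
    exact hsum
  -- (7) the bounds of the torus factors
  have henv : ∀ (n : Fin q → ℕ), ∀ x ∈ C,
      |∏ i, zW Z (fun i x => 1 + κ i x) i x ^ n i - 1| ≤
        ((∏ i, (2 : ℝ) ^ n i) * ∑ i, (n i : ℝ) * 2 ^ n i) * u x :=
    fun n x hx => abs_prod_zW_pow_sub_one_le Z κ n (fun i hi => hZsmall i hi x hx)
  have hlow : ∀ (n : Fin q → ℕ), ∀ x ∈ C, (1 / 2 : ℝ) ^ (∑ i, n i) ≤ ∏ i, zW Z (fun i x => 1 + κ i x) i x ^ n i :=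
    fun n x hx => prod_zW_pow_ge Z κ n (fun i hi => hZsmall i hi x hx)
  -- torus clause, unprimed: qq'_s · (P − 1)^{m+1}
  have hTor : ∀ (n : Fin q → ℕ) s, IntegrableOn (fun x => QQ s x *
      (∏ i, zW Z (fun i x => 1 + κ i x) i x ^ n i - 1) ^ (m + 1)) C := by
    intro n s
    set K : ℝ := (∏ i, (2 : ℝ) ^ n i) * ∑ i, (n i : ℝ) * 2 ^ n i with hK
    have hK0 : 0 ≤ K := by positivity
    refine hQQint _ (K ^ (m + 1)) (by positivity) (aesm (((hPsa n).fun_sub h1).fun_pow (m + 1))) (fun x hx => ?_) s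
    rw [abs_pow, ← mul_pow]
    exact pow_le_pow_left₀ (abs_nonneg _) (henv n x hx) _
  -- torus clause, primed: qq'_s · (1 − P)^{m+1} / P
  have hTor' : ∀ (n : Fin q → ℕ) s, IntegrableOn (fun x => QQ s x *
      ((1 - ∏ i, zW Z (fun i x => 1 + κ i x) i x ^ n i) ^ (m + 1) /
        ∏ i, zW Z (fun i x => 1 + κ i x) i x ^ n i)) C := by
    intro n s
    set K : ℝ := (∏ i, (2 : ℝ) ^ n i) * ∑ i, (n i : ℝ) * 2 ^ n i with hK
    have hK0 : 0 ≤ K := by positivity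
    have hl0 : (0:ℝ) < (1 / 2 : ℝ) ^ (∑ i, n i) := by positivity
    have hPpos : ∀ x ∈ C, 0 < ∏ i, zW Z (fun i x => 1 + κ i x) i x ^ n i := fun x hx => hl0.trans_le (hlow n x hx)
    refine hQQint _ (K ^ (m + 1) / (1 / 2 : ℝ) ^ (∑ i, n i)) (by positivity)
      (aesm (((h1.fun_sub (hPsa n)).fun_pow (m + 1)).div (hPsa n) fun x hx => (hPpos x hx).ne')) (fun x hx => ?_) s
    rw [abs_div, abs_of_pos (hPpos x hx), abs_pow, abs_sub_comm, div_mul_eq_mul_div]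
    rw [div_le_div_iff₀ (hPpos x hx) hl0]
    calc |∏ i, zW Z (fun i x => 1 + κ i x) i x ^ n i - 1| ^ (m + 1) * (1 / 2 : ℝ) ^ (∑ i, n i)
        ≤ (K * u x) ^ (m + 1) * ∏ i, zW Z (fun i x => 1 + κ i x) i x ^ n i := by
          gcongr
          · exact henv n x hx
          · exact hlow n x hx
      _ = K ^ (m + 1) * u x ^ (m + 1) * ∏ i, zW Z (fun i x => 1 + κ i x) i x ^ n i := by rw [mul_pow]
  -- (8) assemble the certificate
  refine ⟨Z, m, a, g, QQ, Nn, hZM, fun r i hi => hgZ r i hi, hrelg, hQQsa, hNnsa,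
    fun i x hx => by rw [hD i x hx]; exact hsplit i x, hsumN, ?_, ?_, ?_, ?_, ?_, ?_, hL, ?_, ?_, ?_, ?_, ?_, ?_⟩
  · -- hZpow: d_i κ_i^{j+1} = c_i κ_i^{j−M_i}, dominated by |c_i|
    intro i hi j hMj _
    have hsa : IsSemialgebraicFunOn ℚ C (fun x => c i x / κ i x ^ (M i + 1) * κ i x ^ (j + 1)) :=
      ((hc i).div ((hκ i).fun_pow (M i + 1)) fun x hx => pow_ne_zero _ (hk0 i (hZσ i hi) x hx)).fun_mul
        ((hκ i).fun_pow (j + 1))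
    refine integrableOn_of_abs_le_mul hCm (hcL1 i hi) (aesm hsa) 1 fun x hx => ?_
    have hκ0 : κ i x ≠ 0 := hk0 i (hZσ i hi) x hx
    have hκpow0 : |κ i x| ^ (M i + 1) ≠ 0 := pow_ne_zero _ (abs_pos.2 hκ0).ne'
    have hpow' : |κ i x| ^ (j + 1) = |κ i x| ^ (M i + 1) * |κ i x| ^ (j - M i) := by
      rw [← pow_add]; congr 1; omega
    rw [abs_mul, abs_div, abs_pow, abs_pow, hpow', ← mul_assoc, div_mul_cancel₀ _ hκpow0, one_mul]
    have h1 : |κ i x| ^ (j - M i) ≤ 1 := pow_le_one₀ (abs_nonneg _) (by linarith [hZsmall i hi x hx])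
    exact mul_le_of_le_one_right (abs_nonneg _) h1
  · -- hZpow'
    intro i hi h1i j hMj _
    have hsa : IsSemialgebraicFunOn ℚ C
        (fun x => c i x / κ i x ^ (M i + 1) * (-κ i x) ^ (j + 1) / (1 + κ i x)) :=
      (((hc i).div ((hκ i).fun_pow (M i + 1)) fun x hx => pow_ne_zero _ (hk0 i (hZσ i hi) x hx)).fun_mul
        ((hκ i).fun_neg.fun_pow (j + 1))).div (h1κ i) fun x hx => (hWpos i x hx).ne'
    refine integrableOn_of_abs_le_mul hCm (hcL1 i hi) (aesm hsa) 2 fun x hx => ?_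
    have hκ0 : κ i x ≠ 0 := hk0 i (hZσ i hi) x hx
    have hW := hWZ i hi x hx
    have hκpow0 : |κ i x| ^ (M i + 1) ≠ 0 := pow_ne_zero _ (abs_pos.2 hκ0).ne'
    have hpow' : |κ i x| ^ (j + 1) = |κ i x| ^ (M i + 1) * |κ i x| ^ (j - M i) := by
      rw [← pow_add]; congr 1; omega
    rw [abs_div, abs_mul, abs_div, abs_pow, abs_pow, abs_neg, abs_of_pos (hWpos i x hx), hpow', ← mul_assoc,
      div_mul_cancel₀ _ hκpow0, div_le_iff₀ (hWpos i x hx)]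
    have h1 : |κ i x| ^ (j - M i) ≤ 1 := pow_le_one₀ (abs_nonneg _) (by linarith [hZsmall i hi x hx])
    calc |c i x| * |κ i x| ^ (j - M i) ≤ |c i x| := mul_le_of_le_one_right (abs_nonneg _) h1
      _ ≤ 2 * |c i x| * (1 + κ i x) := by nlinarith [abs_nonneg (c i x)]
  · -- hqpow: qq'_s κ_i^{m+1}
    intro s i hi
    refine hQQint _ 1 zero_le_one (aesm ((hκ i).fun_pow (m + 1))) (fun x hx => ?_) s
    rw [abs_pow, one_mul]
    exact pow_le_pow_left₀ (abs_nonneg _) (hκu i hi x) _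
  · -- hqpow'
    intro s i hi _
    rw [show (fun x => QQ s x * (-κ i x) ^ (m + 1) / (1 + κ i x)) =
        fun x => QQ s x * ((-κ i x) ^ (m + 1) / (1 + κ i x)) from funext fun x => mul_div_assoc _ _ _]
    refine hQQint _ 2 zero_le_two (aesm (((hκ i).fun_neg.fun_pow (m + 1)).div (h1κ i) fun x hx =>
      (hWpos i x hx).ne')) (fun x hx => ?_) s
    rw [abs_div, abs_pow, abs_neg, abs_of_pos (hWpos i x hx), div_le_iff₀ (hWpos i x hx)]
    have h1 : |κ i x| ^ (m + 1) ≤ u x ^ (m + 1) := pow_le_pow_left₀ (abs_nonneg _) (hκu i hi x) _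
    have hW := hWZ i hi x hx
    have hu := pow_nonneg (hu0 x) (m + 1)
    nlinarith
  · -- hNpow
    intro i hi
    refine hNNint _ 1 (aesm ((hκ i).fun_pow (m + 1))) (fun x hx => ?_) i
    rw [abs_pow]
    exact pow_le_one₀ (abs_nonneg _) (by linarith [hZsmall i hi x hx])
  · -- hNpow'
    intro i hi _
    rw [show (fun x => Nn i x * (-κ i x) ^ (m + 1) / (1 + κ i x)) =
        fun x => Nn i x * ((-κ i x) ^ (m + 1) / (1 + κ i x)) from funext fun x => mul_div_assoc _ _ _]
    refine hNNint _ 2 (aesm (((hκ i).fun_neg.fun_pow (m + 1)).div (h1κ i) fun x hx =>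
      (hWpos i x hx).ne')) (fun x hx => ?_) i
    rw [abs_div, abs_pow, abs_neg, abs_of_pos (hWpos i x hx), div_le_iff₀ (hWpos i x hx)]
    have h1 : |κ i x| ^ (m + 1) ≤ 1 := pow_le_one₀ (abs_nonneg _) (by linarith [hZsmall i hi x hx])
    have hW := hWZ i hi x hx
    nlinarith
  · exact fun r => hTor _ r
  · intro r
    have h1 := hTor' (multUp' (g r) (fun i => decide (σ i ≠ 1))) r
    simpa only [mul_div_assoc] using h1
  · exact fun r => hTor _ r
  · intro r
    have h1 := hTor' (multDn' (g r) (fun i => decide (σ i ≠ 1))) r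
    simpa only [mul_div_assoc] using h1
  · -- hNlog
    intro i
    by_cases hi : Z i = true
    · refine hNNint _ 1 (hlogm i) (fun x hx => ?_) i
      have hW := hWZ i hi x hx
      have hup : Real.log (1 + κ i x) ≤ 1 := by
        have := Real.log_le_sub_one_of_pos (hWpos i x hx)
        linarith [hZsmall i hi x hx, (abs_le.1 (hZsmall i hi x hx)).2]
      have hdn : -1 ≤ Real.log (1 + κ i x) := by
        have h2 : Real.log (1 / 2) ≤ Real.log (1 + κ i x) := Real.log_le_log (by norm_num) hW
        have h3 : Real.log 2 ≤ 1 := by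
          have := Real.log_le_sub_one_of_pos (zero_lt_two' ℝ)
          linarith
        rw [one_div, Real.log_inv] at h2
        linarith
      exact abs_le.2 ⟨hdn, hup⟩
    · have hi' : Z i = false := by simpa using hi
      by_cases h2 : σ i = 2
      · refine IntegrableOn.congr_fun integrableOn_zero (fun x hx => ?_) hCm
        rw [hNnD i hi' x, hD2 i h2 x hx, zero_mul]
      · refine IntegrableOn.congr_fun (((htame i hi' h2).1).const_mul ((-1:ℝ) ^ M i)) (fun x hx => ?_) hCm
        rw [hNnD i hi' x, ← hD i x hx]
        ring
  · -- hNtame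
    intro i h1i j hj
    by_cases hi : Z i = true
    · rw [if_pos hi] at hj
      refine hNNint _ 1 (aesm ((hκ i).fun_pow (j + 1))) (fun x hx => ?_) i
      rw [abs_pow]
      exact pow_le_one₀ (abs_nonneg _) (by linarith [hZsmall i hi x hx])
    · have hi' : Z i = false := by simpa using hi
      rw [if_neg hi] at hj
      by_cases h2 : σ i = 2
      · refine IntegrableOn.congr_fun integrableOn_zero (fun x hx => ?_) hCm
        rw [hNnD i hi' x, hD2 i h2 x hx, zero_mul]
      · refine IntegrableOn.congr_fun (((htame i hi' h2).2 j hj).const_mul ((-1:ℝ) ^ M i)) (fun x hx => ?_) hCm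
        rw [hNnD i hi' x, ← hD i x hx]
        ring

end T3

end Summit.KontsevichZagierPeriods.RootDecompRelativeModAbsolute.Rung30571.RegularisedLogLayer.CylLog.Leaf
end
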